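import Summits.NavierStokesRegularity.OSWSelfSimilar.SheetRTranslationModeWeakEigen
import Summits.NavierStokesRegularity.OSWSelfSimilar.SheetREvenCentreReencoding
import Summits.NavierStokesRegularity.OSWSelfSimilar.SheetREvenLinearisationPerturbation
import Summits.NavierStokesRegularity.OSWSelfSimilar.SheetRSpectrumEvenAssembly
import Summits.NavierStokesRegularity.OSWSelfSimilar.SheetRResolventEvenConj
import HarnessLib

/-!
# Sheet-ℝ spectral certificate (Z3-SR-SPEC, EVEN half): THE END-TO-END WORD FOR THE SHEET —
# «on `Re σ ≥ −3/100` the translation gauge `σ = ½` is the only eigenvalue of `−DG⁺(Ω*)|_{E⁺₀}`, and it is simple»,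
# modulo exactly ONE (S1⁺) Gårding datum at the centre, the interval records `PointDataE` / `MixedFarDatum` / `‖h⁺‖²_w ≤ hw2E`,
# the existence row `‖u‖_E ≤ rE♯₂`, and the weak zero of record

HONEST FRAMING (cell ns-blowup GROUP B «PROFILE SEARCH»; PROFILE-SPEC v1.3 case Z3-SR-SPEC, EVEN half; 1-D MODEL (viscous gCLM/OSW sheet on `ℝ` at
`(a, c_l, ε) = (1/5, 1/2, 1)`); computer-assisted; not Euler/NS; «violates: none — MODEL»; census hook `Literature.Analysis.FluidPDE.effectiveViscosity_half`).
Nothing here is a statement about Navier–Stokes; NO enclosure and NO datum is proved here — this file is pure composition of tree theorems (lead g8 letter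
(kr) rule (b5); seat ns-blowup-profile-cert-5 g9), the even twin of cert-2 g8's odd word `SheetRSpectrumPointEndToEnd`:
* selfsim g14's ABSTRACT even composition `SheetRSpectrumEvenAssembly.eigen_set_eq_singleton` / `eigen_iff_eq_half` / `eigen_half_simple` (cert-2 g10's
  `eq_half_of_pointDataE` instantiated with `J := resolventEven`, (P2)⁺/(P3)⁺) and `SheetRResolventEvenConj.evansEven_conj_real` (hsym for real data);
* cert-5 g9's SHEET-SPECIFIC half: (P8⁺) `SheetREvenLinearisationPerturbation.evansEven_pert_of_record` (the allowance `pert⁺ ≤ 1107/200000` from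
  `‖K′ − K‖ ≤ Δ⁺/2`), `SheetREvenAssemblyOperators` / `SheetREvenSecondVariation` (the concrete `K = −PopCE + θ⟪h⁺, ιEE·⟫h⁺` and `B⁺_u` with
  `‖B⁺_u‖ ≤ Δ⁺/2` on the certified ball), `SheetREvenCentreReencoding` (the `Ω*` encoding and the centre encoding have the same Gårding data, resolvent
  and Evans function), `SheetRTranslationModeWeakEigen.eigen_half_of_centre` (PO⁺: the translation mode `Ω*′` is an eigenvector of `T⁺*` at `½`).
THE WORD (`eigen_set_eq_singleton_of_record`, `eigen_iff_eq_half_of_record`, `eigen_half_simple_of_record`), frame of record `L = 8`, `a = 1/5`, `λ = 4`,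
`θ = 4`, `f = h = h⁺` real even zero-mass: for `T⁺* := generatorEven` of the `Ω*` encoding `(drift (1/5) Ω*, potential 8 4 Ω*, −PopCE* + 4⟪h⁺, ιEE·⟫h⁺)`
with the DERIVED datum `gardingDataKE_star_of_centre` (from the centre datum by (P8⁺) + re-encoding),
«{σ : Re σ ≥ −3/100 ∧ ∃ v ≠ 0 in D(T⁺*), T⁺*v = σv − 4⟪h⁺,v⟫h⁺} = {½}», «at ½: `R⁺*(½)h⁺ ≠ 0` spans the eigenline, no generalized eigenvector»
(in the cell's dictionary `T⁺* + 4⟪h⁺,·⟫h⁺ = −DG⁺(Ω*)|_{E⁺₀}`, `SheetRGeneratorEvenWeak.mem_domainE_iff`), MODULO EXACTLY: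
  (S1⁺) `hS1 : GardingDataKE 8 h8 (drift (1/5) Ω̄) (potential 8 4 Ω̄) (−PopCĒ + 4⟪h⁺, ιEE·⟫h⁺) D₀ D₁ V₀ c m` with `c ≥ c₂`, `m ≥ c₁ + γ` [INTERVAL, two arithmetics];
  `hu : ‖u‖_E ≤ rE♯₂` with `Ω* = Ω̄ + prim (der u)` [existence row]; `hPD : PointDataE`, `hFD : MixedFarDatum`, `hhw : ‖h⁺‖²_w ≤ hw2E` [interval records BY NAME,
  implementation 2 of record]; the weak zero of record `hweak` with `Ω*(X₀) ≠ 0` [NK row]; and the data shapes `hc`, `hcs` (centre data of `Ω̄`, `Ω*`),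
  `h⁺ ∈ WevenZ`, `[CompleteSpace (WcevenZ h8)]` (dischargeable by `completeSpace_WcevenZ`).
WHAT THIS IS NOT: not NS; not a proof that the records hold; no number of record moves; no census word is asserted by this file.
-/

noncomputable section

namespace Summit.NavierStokesRegularity.OSWSelfSimilar
namespace SheetRSpectrumEvenEndToEnd

open _root_.MeasureTheory _root_.Set _root_.Filter _root_.Real Literature.Analysis.Fourier SheetRWeakProfilePV SheetRWeakToStrong
  SheetREnergyClass SheetRWeightedMeasure SheetREnergySpace SheetRLinearisedTests SheetRTestSpace SheetRLinearisedFormBounds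
  SheetRSolutionOperator SheetRComplexPivot SheetRAssemblyOperators SheetRCertificateAssembly SheetREvenTests SheetREvenEnergySpace
  SheetREvenForms SheetREvenPairUniqueness SheetREvenResolvent SheetREvenClass SheetRResolventEvenClass SheetRGeneratorEvenWeak SheetREvansEven
  SheetREvenAssemblyOperators SheetREvenSecondVariation SheetREvenEnergySpaceOf SheetRTranslationModeWeakEigen SheetREvenCentreReencoding
  SheetREvenLinearisationPerturbation SheetRSpectrumStepRule SheetRSpectrumEvenWindingLists SheetRSpectrumEvenPointCertificate
  SheetRSpectrumEvenPointAssembly SheetRSpectrumEvenAssembly SheetRResolventEvenConj SheetRWeakEigenReal Literature.Analysis.OperatorTheory Complex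
open scoped Topology ENNReal ContDiff InnerProductSpace ComplexConjugate

section Record

open CertificateViscousSheetRSpectrum (c1 c2 gamma)
open CertificateViscousSheetRSpectrumEven (DeltaE hw2E)
open CertificateViscousSheetR (rEsharp2)

variable {h8 : (0 : ℝ) < 8} [CompleteSpace (WcevenZ h8)] {Ω Ω₁ Ωs Ωs₁ : ℝ → ℝ} {H₀ Hs : ℝ}
  (hc : IsCentre 8 Ω Ω₁ H₀) (hcs : IsCentre 8 Ωs Ωs₁ Hs) (u : Esp 8 h8) (hsum : ∀ y, Ωs y = Ω y + prim (der u) y)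
  {hE : W 8} (hhE : hE ∈ WevenZ h8) {D₀ D₁ V₀ c m : ℝ}
  (hS1 : GardingDataKE 8 h8 (drift (1 / 5) Ω) (potential 8 4 Ω)
    (-PopCE h8 4 (1 / 5) hc + (((4 : ℝ) • ((innerSL ℝ hE).comp (ιEE h8))).smulRight hE)) D₀ D₁ V₀ c m)
  (hc2 : ((c2 : ℚ) : ℝ) ≤ c) (hm : ((c1 : ℚ) : ℝ) + ((gamma : ℚ) : ℝ) ≤ m) (hu : ‖u‖ ≤ (rEsharp2 : ℝ))

/-! ### §1 The (S1⁺) datum moved to `Ω*`: (P8⁺) + re-encoding -/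

omit [CompleteSpace (WcevenZ h8)] in
include hu in
/-- **`‖K̄⁺_u − K̄‖ = ‖B⁺_u‖ ≤ Δ⁺/2`** on the certified ball (`SheetREvenSecondVariation.norm_add_secondVariationE_sub_le`). [folklore] -/
theorem norm_sub_le_half_DeltaE :
    ‖(-PopCE h8 4 (1 / 5) hc + (((4 : ℝ) • ((innerSL ℝ hE).comp (ιEE h8))).smulRight hE) + secondVariationE h8 (1 / 5) u)
        - (-PopCE h8 4 (1 / 5) hc + (((4 : ℝ) • ((innerSL ℝ hE).comp (ιEE h8))).smulRight hE))‖ ≤ ((DeltaE : ℚ) : ℝ) / 2 :=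
  norm_add_secondVariationE_sub_le h8 _ u hu

omit [CompleteSpace (WcevenZ h8)] in
include hS1 hc2 hu in
/-- **The centre-encoded datum at `Ω*`**: `(c − Δ⁺, m − Δ⁺/4)` for `K̄⁺_u = K̄ + B⁺_u` (`gardingDataKE_of_record`). MODEL statement; not NS. [folklore] -/
theorem gardingDataKE_centre_perturbed :
    GardingDataKE 8 h8 (drift (1 / 5) Ω) (potential 8 4 Ω)
      (-PopCE h8 4 (1 / 5) hc + (((4 : ℝ) • ((innerSL ℝ hE).comp (ιEE h8))).smulRight hE) + secondVariationE h8 (1 / 5) u) D₀ D₁ V₀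
      (c - ((DeltaE : ℚ) : ℝ)) (m - ((DeltaE : ℚ) : ℝ) / 4) :=
  gardingDataKE_of_record hS1 _ (norm_sub_le_half_DeltaE hc u hu) (DeltaE_lt_of_c2_le hc2)

omit [CompleteSpace (WcevenZ h8)] in
include hS1 hc2 hu hsum in
/-- **THE (S1⁺) DATUM AT `Ω*`, `Ω*` ENCODING** (`drift (1/5) Ω*, potential 8 4 Ω*, −PopCE* + 4⟪h⁺, ιEE·⟫h⁺`), constants `(c − Δ⁺, m − Δ⁺/4)`: the centre datum
moved by (P8⁺) and re-encoded (`SheetREvenCentreReencoding.gardingDataKE_reencode`). MODEL statement; not NS. [folklore] -/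
theorem gardingDataKE_star_of_centre :
    GardingDataKE 8 h8 (drift (1 / 5) Ωs) (potential 8 4 Ωs)
      (-PopCE h8 4 (1 / 5) hcs + (((4 : ℝ) • ((innerSL ℝ hE).comp (ιEE h8))).smulRight hE))
      (|(1 / 5 : ℝ)| * (Real.sqrt (π / (4 * 8)) * Real.sqrt (∫ y, ((8 : ℝ) ^ 2 + y ^ 2) * Ωs y ^ 2))) (1 / 2) (1 + Hs + |(4 : ℝ)|)
      (c - ((DeltaE : ℚ) : ℝ)) (m - ((DeltaE : ℚ) : ℝ) / 4) :=
  gardingDataKE_reencode h8 4 (1 / 5) hc hcs u hsum _ (gardingDataKE_centre_perturbed hc u hS1 hc2 hu)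

/-! ### §2 The hypotheses of the abstract even assembly, DISCHARGED for the sheet -/

omit [CompleteSpace (WcevenZ h8)] in
/-- `h⁺ + 0i` is real: `Im = 0`. [folklore] -/
theorem imW_realE : imW 8 (realE h8 hE hhE : Wc 8) = 0 := (reW_imW_ofRealW (L := 8) hE).2

omit [CompleteSpace (WcevenZ h8)] in
include hS1 in
/-- **hsym DISCHARGED** (selfsim's `evansEven_conj_real` for the real data of record, `θ = 4`). [folklore] -/
theorem evansEven_symm_of_record (w : ℂ) :
    evansEven h8 _ hS1 (innerSL ℂ (realE h8 hE hhE)) (realE h8 hE hhE) 4 (conj w) =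
      conj (evansEven h8 _ hS1 (innerSL ℂ (realE h8 hE hhE)) (realE h8 hE hhE) 4 w) := by
  have e4 : ((4 : ℝ) : ℂ) = (4 : ℂ) := by norm_num
  have h := evansEven_conj_real hS1 (imW_realE hhE) (imW_realE hhE) (4 : ℝ) w
  rw [e4] at h
  exact h

omit [CompleteSpace (WcevenZ h8)] in
include hS1 hc2 hm hu hsum in
/-- **hpert DISCHARGED**: the `Ω*`-encoded Evans function (datum `gardingDataKE_star_of_centre`) differs from the centre's by at most
`pert₀ = 4·(hw2E·(Δ⁺/2)·20)/(3/25 − Δ⁺/4) ≤ 1107/200000` on `Re w ≥ −3/100` (re-encoding `evansEven_reencode` + (P8⁺) `evansEven_pert_of_record`).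
MODEL statement; not NS. [folklore] -/
theorem evansEven_pert_star (hhw : ‖realE h8 hE hhE‖ ^ 2 ≤ ((hw2E : ℚ) : ℝ)) :
    (∀ w : ℂ, ra ≤ w.re →
        ‖evansEven h8 _ (gardingDataKE_star_of_centre hc hcs u hsum hS1 hc2 hu) (innerSL ℂ (realE h8 hE hhE)) (realE h8 hE hhE) 4 w
            - evansEven h8 _ hS1 (innerSL ℂ (realE h8 hE hhE)) (realE h8 hE hhE) 4 w‖ ≤
          (4 : ℝ) * (((hw2E : ℚ) : ℝ) * (((DeltaE : ℚ) : ℝ) / 2 * 20)) / ((3 : ℝ) / 25 - ((DeltaE : ℚ) : ℝ) / 4)) ∧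
      (4 : ℝ) * (((hw2E : ℚ) : ℝ) * (((DeltaE : ℚ) : ℝ) / 2 * 20)) / ((3 : ℝ) / 25 - ((DeltaE : ℚ) : ℝ) / 4) ≤ (1107 : ℝ) / 200000 := by
  obtain ⟨hp, hp'⟩ := evansEven_pert_of_record hS1 (gardingDataKE_centre_perturbed hc u hS1 hc2 hu) hc2 hm le_rfl
    (norm_sub_le_half_DeltaE hc u hu) (realE h8 hE hhE) hhw
  have hre := evansEven_reencode h8 4 (1 / 5) hc hcs u hsum _ (gardingDataKE_centre_perturbed hc u hS1 hc2 hu)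
    (gardingDataKE_star_of_centre hc hcs u hsum hS1 hc2 hu) (innerSL ℂ (realE h8 hE hhE)) (realE h8 hE hhE) (4 : ℂ)
  refine ⟨fun w hw => ?_, hp'⟩
  rw [hre]
  exact hp w hw

omit [CompleteSpace (WcevenZ h8)] in
include hm in
/-- `−(m − Δ⁺/4) < −3/100` for the derived datum (`neg_mstar_lt_raE`). [folklore] -/
theorem neg_mstar_lt_ra' : -(m - ((DeltaE : ℚ) : ℝ) / 4) < ra := neg_mstar_lt_raE hm

omit [CompleteSpace (WcevenZ h8)] in
include hm in
/-- `3/20 ≤ m` (from `m ≥ c₁ + γ`). [folklore] -/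
theorem three_twentieths_le_m : (3 : ℝ) / 20 ≤ m := by
  have hcg : ((c1 : ℚ) : ℝ) + ((gamma : ℚ) : ℝ) = 3 / 20 := by norm_num [c1, gamma]
  linarith

omit [CompleteSpace (WcevenZ h8)] in
include hS1 hc2 hm hu hsum in
/-- **hv0/hv1 DISCHARGED (PO⁺)**: from the weak zero of record with `Ω*(X₀) ≠ 0`, the translation mode `v := Ω*′ + 0i = cplxE P ≠ 0` lies in `D(T⁺*)` for the
derived datum with `T⁺*v = ½v − (4⟪h⁺+0i, v⟫)(h⁺+0i)` (`SheetRTranslationModeWeakEigen.eigen_half_of_centre`). MODEL statement; not NS. [folklore] -/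
theorem translationMode_of_record
    (hweak : ∀ ψ : ℝ → ℝ, ContDiff ℝ ∞ ψ → HasCompactSupport ψ →
      (∫ x, (Ωs x + 1 / 2 * x * Ωs₁ x + 1 / 5 * (∫ s in (0 : ℝ)..x, hilbertTransform Ωs s) * Ωs₁ x
        - hilbertTransform Ωs x * Ωs x) * ψ x) + ∫ x, Ωs₁ x * deriv ψ x = 0)
    {X₀ : ℝ} (hX₀ : Ωs X₀ ≠ 0) :
    ∃ P : EspE 8 h8, profile P = deriv Ωs ∧ cplxE h8 P ≠ 0 ∧
      ∃ hdom : cplxE h8 P ∈ (generatorEven h8 _ (gardingDataKE_star_of_centre hc hcs u hsum hS1 hc2 hu) ((1 : ℂ) / 2)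
          (lt_trans (neg_mstar_lt_ra' hm) ra_lt_half_re)).domain,
        generatorEven h8 _ (gardingDataKE_star_of_centre hc hcs u hsum hS1 hc2 hu) ((1 : ℂ) / 2)
            (lt_trans (neg_mstar_lt_ra' hm) ra_lt_half_re) ⟨cplxE h8 P, hdom⟩ =
          ((1 : ℂ) / 2) • cplxE h8 P - ((4 : ℂ) * innerSL ℂ (realE h8 hE hhE) (cplxE h8 P)) • realE h8 hE hhE := by
  obtain ⟨P, hPv, hP0, hP1⟩ := eigen_half_of_centre h8 4 (1 / 5) hcs hweak hX₀ hhE (4 : ℝ)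
  have e4 : ((4 : ℝ) : ℂ) = (4 : ℂ) := by norm_num
  obtain ⟨hu', hT⟩ := hP1 (gardingDataKE_star_of_centre hc hcs u hsum hS1 hc2 hu) (lt_trans (neg_mstar_lt_ra' hm) ra_lt_half_re)
  rw [e4] at hT
  exact ⟨P, hPv, hP0, hu', hT⟩

/-! ### §3 THE EVEN WORD FOR THE SHEET -/

variable (hPD : PointDataE (resolventEven h8 _ hS1) (realE h8 hE hhE) (realE h8 hE hhE) 4
    (evansEven h8 _ hS1 (innerSL ℂ (realE h8 hE hhE)) (realE h8 hE hhE) 4))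
  (hFD : MixedFarDatum (resolventEven h8 _ hS1) (realE h8 hE hhE) (realE h8 hE hhE) 1 ((10075811313 : ℝ) / 10000000000)
    ((754639259 : ℝ) / 200000000) ((1011518153 : ℝ) / 250000000) ((4049925993 : ℝ) / 1000000000))
  (hhw : ‖realE h8 hE hhE‖ ^ 2 ≤ ((hw2E : ℚ) : ℝ))
  (hweak : ∀ ψ : ℝ → ℝ, ContDiff ℝ ∞ ψ → HasCompactSupport ψ →
    (∫ x, (Ωs x + 1 / 2 * x * Ωs₁ x + 1 / 5 * (∫ s in (0 : ℝ)..x, hilbertTransform Ωs s) * Ωs₁ x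
      - hilbertTransform Ωs x * Ωs x) * ψ x) + ∫ x, Ωs₁ x * deriv ψ x = 0)
  {X₀ : ℝ} (hX₀ : Ωs X₀ ≠ 0)

include hm hPD hFD hhw hweak hX₀ in
/-- **Z3-SR-SPEC EVEN HALF, THE PASS WORD FOR THE SHEET (set form).** On `Re σ ≥ −3/100` the set of `σ` carrying a non-zero `v ∈ D(T⁺*)` with
`T⁺*v = σv − 4⟪h⁺,v⟫h⁺` — an eigenvector of `−DG⁺(Ω*)|_{E⁺₀}` at `σ` — is EXACTLY `{½}` (the translation gauge). Hypotheses: see the module docstring.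
MODEL statement; not NS. [folklore] -/
theorem eigen_set_eq_singleton_of_record :
    {σ : ℂ | ∃ hσ : ra ≤ σ.re, ∃ v : WcevenZ h8, v ≠ 0 ∧
        ∃ hv : v ∈ (generatorEven h8 _ (gardingDataKE_star_of_centre hc hcs u hsum hS1 hc2 hu) σ
            (lt_of_lt_of_le (neg_mstar_lt_ra' hm) hσ)).domain,
          generatorEven h8 _ (gardingDataKE_star_of_centre hc hcs u hsum hS1 hc2 hu) σ (lt_of_lt_of_le (neg_mstar_lt_ra' hm) hσ) ⟨v, hv⟩ =
            σ • v - ((4 : ℂ) * innerSL ℂ (realE h8 hE hhE) v) • realE h8 hE hhE} = {(1 : ℂ) / 2} := by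
  obtain ⟨hpert, hpert'⟩ := evansEven_pert_star hc hcs u hsum hhE hS1 hc2 hm hu hhw
  obtain ⟨P, -, hv0, hv1⟩ := translationMode_of_record hc hcs u hsum hhE hS1 hc2 hm hu hweak hX₀
  have hθ : ‖(4 : ℂ)‖ ≤ 4 := by simp
  exact eigen_set_eq_singleton h8 _ hS1 _ (gardingDataKE_star_of_centre hc hcs u hsum hS1 hc2 hu) (three_twentieths_le_m hm)
    (neg_mstar_lt_ra' hm) (realE h8 hE hhE) (4 : ℂ) hθ (evansEven_symm_of_record hc hhE hS1) hpert hpert' hPD hFD hv0 hv1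

include hm hPD hFD hhw hweak hX₀ in
/-- **… existence/uniqueness form**: for every `σ` with `Re σ ≥ −3/100`, a non-zero eigenvector of `T⁺* + 4⟪h⁺,·⟫h⁺` at `σ` exists iff `σ = ½`.
MODEL statement; not NS. [folklore] -/
theorem eigen_iff_eq_half_of_record {σ : ℂ} (hσ : ra ≤ σ.re) :
    (∃ v : WcevenZ h8, v ≠ 0 ∧
        ∃ hv : v ∈ (generatorEven h8 _ (gardingDataKE_star_of_centre hc hcs u hsum hS1 hc2 hu) σ
            (lt_of_lt_of_le (neg_mstar_lt_ra' hm) hσ)).domain,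
          generatorEven h8 _ (gardingDataKE_star_of_centre hc hcs u hsum hS1 hc2 hu) σ (lt_of_lt_of_le (neg_mstar_lt_ra' hm) hσ) ⟨v, hv⟩ =
            σ • v - ((4 : ℂ) * innerSL ℂ (realE h8 hE hhE) v) • realE h8 hE hhE) ↔ σ = (1 : ℂ) / 2 := by
  obtain ⟨hpert, hpert'⟩ := evansEven_pert_star hc hcs u hsum hhE hS1 hc2 hm hu hhw
  obtain ⟨P, -, hv0, hv1⟩ := translationMode_of_record hc hcs u hsum hhE hS1 hc2 hm hu hweak hX₀
  have hθ : ‖(4 : ℂ)‖ ≤ 4 := by simp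
  exact eigen_iff_eq_half h8 _ hS1 _ (gardingDataKE_star_of_centre hc hcs u hsum hS1 hc2 hu) (three_twentieths_le_m hm)
    (neg_mstar_lt_ra' hm) (realE h8 hE hhE) (4 : ℂ) hθ (evansEven_symm_of_record hc hhE hS1) hpert hpert' hPD hFD hv0 hv1 hσ

include hm hPD hFD hhw hweak hX₀ in
/-- **… simplicity at `½`**: `R⁺*(½)(h⁺+0i) ≠ 0`, the eigenvectors of `T⁺* + 4⟪h⁺,·⟫h⁺` at `½` are exactly its complex multiples (so the translation mode
`Ω*′` spans the eigenline), and there is no generalized eigenvector over a non-zero eigenvector (algebraically simple). MODEL statement; not NS. [folklore] -/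
theorem eigen_half_simple_of_record :
    resolventEven h8 _ (gardingDataKE_star_of_centre hc hcs u hsum hS1 hc2 hu) ((1 : ℂ) / 2) (realE h8 hE hhE) ≠ 0 ∧
      (∀ v : WcevenZ h8,
        (∃ hv : v ∈ (generatorEven h8 _ (gardingDataKE_star_of_centre hc hcs u hsum hS1 hc2 hu) ((1 : ℂ) / 2)
            (lt_trans (neg_mstar_lt_ra' hm) ra_lt_half_re)).domain,
          generatorEven h8 _ (gardingDataKE_star_of_centre hc hcs u hsum hS1 hc2 hu) ((1 : ℂ) / 2)
              (lt_trans (neg_mstar_lt_ra' hm) ra_lt_half_re) ⟨v, hv⟩ =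
            ((1 : ℂ) / 2) • v - ((4 : ℂ) * innerSL ℂ (realE h8 hE hhE) v) • realE h8 hE hhE) ↔
        ∃ t : ℂ, v = t • resolventEven h8 _ (gardingDataKE_star_of_centre hc hcs u hsum hS1 hc2 hu) ((1 : ℂ) / 2) (realE h8 hE hhE)) ∧
      ∀ δ₀ : WcevenZ h8, δ₀ ≠ 0 →
        (∃ hv : δ₀ ∈ (generatorEven h8 _ (gardingDataKE_star_of_centre hc hcs u hsum hS1 hc2 hu) ((1 : ℂ) / 2)
            (lt_trans (neg_mstar_lt_ra' hm) ra_lt_half_re)).domain,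
          generatorEven h8 _ (gardingDataKE_star_of_centre hc hcs u hsum hS1 hc2 hu) ((1 : ℂ) / 2)
              (lt_trans (neg_mstar_lt_ra' hm) ra_lt_half_re) ⟨δ₀, hv⟩ =
            ((1 : ℂ) / 2) • δ₀ - ((4 : ℂ) * innerSL ℂ (realE h8 hE hhE) δ₀) • realE h8 hE hhE) →
        ¬ ∃ δ₁ : WcevenZ h8, ∃ hv : δ₁ ∈ (generatorEven h8 _ (gardingDataKE_star_of_centre hc hcs u hsum hS1 hc2 hu) ((1 : ℂ) / 2)
            (lt_trans (neg_mstar_lt_ra' hm) ra_lt_half_re)).domain,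
          generatorEven h8 _ (gardingDataKE_star_of_centre hc hcs u hsum hS1 hc2 hu) ((1 : ℂ) / 2)
              (lt_trans (neg_mstar_lt_ra' hm) ra_lt_half_re) ⟨δ₁, hv⟩ =
            ((1 : ℂ) / 2) • δ₁ - ((4 : ℂ) * innerSL ℂ (realE h8 hE hhE) δ₁) • realE h8 hE hhE + δ₀ := by
  obtain ⟨hpert, hpert'⟩ := evansEven_pert_star hc hcs u hsum hhE hS1 hc2 hm hu hhw
  obtain ⟨P, -, hv0, hv1⟩ := translationMode_of_record hc hcs u hsum hhE hS1 hc2 hm hu hweak hX₀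
  have hθ : ‖(4 : ℂ)‖ ≤ 4 := by simp
  exact eigen_half_simple h8 _ hS1 _ (gardingDataKE_star_of_centre hc hcs u hsum hS1 hc2 hu) (three_twentieths_le_m hm)
    (neg_mstar_lt_ra' hm) (realE h8 hE hhE) (4 : ℂ) hθ (evansEven_symm_of_record hc hhE hS1) hpert hpert' hPD hFD hv0 hv1

include hm hPD hFD hhw hweak hX₀ in
/-- **The translation mode spans the eigenline at `½`** (packaged corollary): there is `P ∈ EspE` with `profile P = Ω*′`, `cplxE P ≠ 0`, and
`cplxE P = t • R⁺*(½)(h⁺+0i)` for some `t ∈ ℂ`. MODEL statement; not NS. [folklore] -/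
theorem translationMode_spans_eigenline :
    ∃ (P : EspE 8 h8) (t : ℂ), profile P = deriv Ωs ∧ cplxE h8 P ≠ 0 ∧
      cplxE h8 P = t • resolventEven h8 _ (gardingDataKE_star_of_centre hc hcs u hsum hS1 hc2 hu) ((1 : ℂ) / 2) (realE h8 hE hhE) := by
  obtain ⟨-, hline, -⟩ := eigen_half_simple_of_record hc hcs u hsum hhE hS1 hc2 hm hu hPD hFD hhw hweak hX₀
  obtain ⟨P, hPv, hv0, hv1⟩ := translationMode_of_record hc hcs u hsum hhE hS1 hc2 hm hu hweak hX₀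
  obtain ⟨t, ht⟩ := (hline (cplxE h8 P)).1 hv1
  exact ⟨P, t, hPv, hv0, ht⟩

end Record

end SheetRSpectrumEvenEndToEnd
end Summit.NavierStokesRegularity.OSWSelfSimilar

end
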